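import Summits.ResolutionOfSingularities.ResolutionOfSingularities.Theorems.MarkedTransferCampaignW21AlongCentre
import HarnessLib

/-!
# [OURS · L1 W2.1] The D-ADIC class: along a COORDINATE centre `D = V(x_{w(1)}, …, x_{w(c)})` the Lucas bookkeeping
# bounds `ord_D H♭(ε)` below by `q·min_j |γ_j|_D + s_D` — statements (the class on which the §16 USE holds)

Rung L (rescue) of cell res-hironaka, RESCUE-SEED row L-G2, slot W2.1 (USE half), seat res-L1-s21-pv-1 (gen 2). The
companions (`…AlongCentre.lean` p499848, `…AlongCentreBounds.lean` p500718, `…AlongCentreWitness.lean` p500590,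
`…AlongCentreRefutation.lean`) show that the classes mined AT `ξ` (`MinDegreeTop ⊆ LucasClass ⊆ ExactClass`) do NOT carry
the D-adic inequality «ord_D(h(i)) ≥ p^{e−i}» that the proof of Lem. 16.7 (p.85 L10–L11 of the manuscript under
adjudication; typed AS PRINTED `S16Proof.U85L8` (b)) consumes, once `dim D ≥ 1`, `codim D ≥ 2`. THIS FILE names the
class that DOES — the RESCUE-SEED lever «find the largest class on which [the bound] holds» read for the inequality that
is actually used: the same Lucas bookkeeping as AT `ξ` (group-2 DOSSIER §3.1; res-L1-k21 KILL-TEST-K2.1 §6 «D-adic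
reading: the same shadow mechanism operates D-adically»), with total degrees replaced by D-DEGREES. For a COORDINATE
centre `D = V(x_{w 0}, …, x_{w (c−1)})` (`w : Fin c → Fin n` injective; prime `P_w = (x_{w j})_j` of `K⟦x⟧`, a permissible
centre germ in the sense of row 014 whenever `ord_D ε ≥ q`): `|m|_D := Σ_j m_{w j}` (`degAlong w m`), and
`ord_D(u₀⁻¹ ∂^{(α+pβ)}ε · ∂^{(qγ₀)}ε) ≥ q·min_j |γ_j|_D + s_D`, `s_D := min {|a+pb+qc|_D − q|γ₀|_D : u(a,b,c) ≠ 0,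
γ₀ ≼_p c, qγ₀ ≤ a+pb+qc}` (each factor's D-order bounded termwise; proved in `…AlongCentreClassProof.lean`). Hence the
WEAK D-adic bound `q ≤ ord_D H♭(ε)` holds on the class `CentreWeakClass w` := «`min_j |γ_j|_D ≥ 1`, or every admissible
shadow has `|a+pb+qc|_D ≥ q|γ₀|_D + q`» — typed without `min` as one inequality per pair `(j, t)`. General smooth centre
germs `P` (row 014: `K⟦x⟧/P` regular) are coordinate centres after a change of the regular system of parameters
(Matsumura 14.2); the standard expression is tied to the given parameters, so only coordinate centres are typed
(`-- TODO(general form)`). The witness of `…AlongCentreWitness.lean` violates the class along `w = (0, 1)`: its shadow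
`ω₁^p ω₂^{p²+p}` has `|·|_D = p = q|γ₀|_D` while `|γ₁|_D = |(0,0,2)|_D = 0`. Everything here is OURS; nothing is a statement
of or about the manuscript; AI review is weaker than expert review.
-/

noncomputable section

set_option linter.dupNamespace false -- mandated namespace of this single-conjunct summit

namespace Summit.ResolutionOfSingularities.ResolutionOfSingularities.Theorems

namespace CampaignW21

open Literature.AlgebraicGeometry.Hironaka2017.S08UnitMonomial
open Literature.AlgebraicGeometry.Hironaka2017.S09LLUED
open Literature.AlgebraicGeometry.Hironaka2017.S09LLUED.TopFrontier
open Literature.AlgebraicGeometry.Resolution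

/-- OURS plumbing: the D-DEGREE `|m|_D = Σ_j m_{w j}` of a multi-index along the coordinate centre
`D = V(x_{w 0}, …, x_{w (c−1)})` (the order of the monomial `x^m` along `D`). [folklore] -/
def degAlong {n c : ℕ} (w : Fin c → Fin n) (m : Fin n →₀ ℕ) : ℕ := ∑ j, m (w j)

/-- OURS plumbing: the prime `P_w = (x_{w 0}, …, x_{w (c−1)})` of `K⟦x₁…xₙ⟧` — the germ at `ξ` of the coordinate centre
`D = V(x_{w j})_j` (for `w` injective it is generated by a part of a regular system of parameters, tree
`MvPowerSeries.isRsopPart_X_of_injective`: prime, with regular quotient). [folklore] -/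
def centreIdeal (K : Type) [Field K] {n c : ℕ} (w : Fin c → Fin n) : Ideal (MvPowerSeries (Fin n) K) :=
  Ideal.span (Set.range fun j => (MvPowerSeries.X (w j) : MvPowerSeries (Fin n) K))

section Data

variable {K : Type} [Field K] {n ℓ : ℕ}

/-- [OURS · L1 W2.1] the D-ADIC WEAK CLASS along the coordinate centre `w` — the class of standard-expression data on
which the D-adic Lucas bookkeeping gives the CONSUMED inequality «ord_D H♭(ε) ≥ q» (`q = p^e`): for every top-block
index `j` and every effective term `t = (a,b,c)` whose `c` dominates `γ₀` digitwise (`DigitLE`, the survivors of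
`∂^{(qγ₀)}`) and with `qγ₀ ≤ a+pb+qc`, `q + q|γ₀|_D ≤ q|γ_j|_D + |a+pb+qc|_D`. (Equivalently: `min_j|γ_j|_D ≥ 1`, or every
such `t` has `|a+pb+qc|_D ≥ q|γ₀|_D + q`.) Replaces the role of a hypothesis under which p.85 L10–L11's consumed
inequality holds for the single-step Case-(I) value; NOT a statement of the manuscript. REAL predicate. [folklore] -/
def CentreWeakClass {c : ℕ} (w : Fin c → Fin n) (p e : ℕ) (ε : MvPowerSeries (Fin n) K)
    (S : StandardExpression p (xs K n) e ℓ ε) : Prop :=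
  ∀ (h0 : 0 < frontierLength S.support S.u) (j : Fin (frontierLength S.support S.u)),
    ∀ t ∈ effSupport S.support S.u, (∀ i : Fin n, DigitLE p (gamma S.support S.u ⟨0, h0⟩ i) (t.2.2 i)) →
      p ^ e • gamma S.support S.u ⟨0, h0⟩ ≤ t.1 + p • t.2.1 + p ^ e • t.2.2 →
        p ^ e + p ^ e * degAlong w (gamma S.support S.u ⟨0, h0⟩) ≤
          p ^ e * degAlong w (gamma S.support S.u j) + degAlong w (t.1 + p • t.2.1 + p ^ e • t.2.2)

end Data

/-- [OURS · L1 W2.1] THE D-ADIC LUCAS BOUND along coordinate centres (per prime `p`): for every field `K` of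
characteristic `p`, all `n, e > 0, ℓ`, every `ε ∈ K⟦x⟧` with a standard expression `S`, non-empty top block and
`Standing`, every injective `w : Fin c → Fin n`, and all `μ s : ℕ` with `μ ≤ |γ_j|_D` for all `j` and
`s + q|γ₀|_D ≤ |a+pb+qc|_D` for every effective `(a,b,c)` with `γ₀ ≼_p c` and `qγ₀ ≤ a+pb+qc`:
`q·μ + s ≤ ord_{P_w} H♭(ε)` (single-step Case-(I) value, `ordAlong` of row 014). The D-adic form of the Lucas bookkeeping
(DOSSIER §3.1) — replaces the role of a D-adic order computation the manuscript does not print; NOT a statement of the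
manuscript. No case hypothesis and no class needed. -- TODO(general form): arbitrary smooth centre germs `P`.
[folklore] -/
def CentreLucasBoundPos (p : ℕ) [Fact p.Prime] : Prop :=
  ∀ (K : Type) [Field K] [CharP K p] (n e ℓ : ℕ) (_he : 0 < e) (ε : MvPowerSeries (Fin n) K)
    (S : StandardExpression p (xs K n) e ℓ ε) (h0 : 0 < frontierLength S.support S.u)
    (hS : Standing p e ℓ ε S h0) (c : ℕ) (w : Fin c → Fin n) (_hw : Function.Injective w) (μ s : ℕ),
    (∀ j : Fin (frontierLength S.support S.u), μ ≤ degAlong w (gamma S.support S.u j)) →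
    (∀ t ∈ effSupport S.support S.u, (∀ i : Fin n, DigitLE p (gamma S.support S.u ⟨0, h0⟩ i) (t.2.2 i)) →
      p ^ e • gamma S.support S.u ⟨0, h0⟩ ≤ t.1 + p • t.2.1 + p ^ e • t.2.2 →
        s + p ^ e * degAlong w (gamma S.support S.u ⟨0, h0⟩) ≤ degAlong w (t.1 + p • t.2.1 + p ^ e • t.2.2)) →
    ∀ [(centreIdeal K w).IsPrime],
      ((p ^ e * μ + s : ℕ) : ℕ∞) ≤
        ordAlong (MvPowerSeries (Fin n) K) (centreIdeal K w)
          (HFlat.caseI (hasseD K n) hS.unit_u0.unit p (p ^ e)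
            (alpha S.support S.u) (beta S.support S.u) (gamma S.support S.u ⟨0, h0⟩) ε)

/-- [OURS · L1 W2.1] THE CONSUMED D-ADIC INEQUALITY ON THE D-ADIC CLASS, coordinate centres (per prime `p`): for every
datum as above, Case (I) or not, every injective `w` with the datum in `CentreWeakClass w`: `q ≤ ord_{P_w} H♭(ε)`.
Replaces the role of p.85 L10–L11 «ord_D(h(i)) ≥ … ≥ p^{e−i}» for the single-step Case-(I) value on that class; NOT a
statement of the manuscript. (The permissibility hypothesis `ord_D ε ≥ q` is not even needed for this direction.)
[folklore] -/
def CentreWeakBoundCoordPos (p : ℕ) [Fact p.Prime] : Prop :=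
  ∀ (K : Type) [Field K] [CharP K p] (n e ℓ : ℕ) (_he : 0 < e) (ε : MvPowerSeries (Fin n) K)
    (S : StandardExpression p (xs K n) e ℓ ε) (h0 : 0 < frontierLength S.support S.u)
    (hS : Standing p e ℓ ε S h0) (c : ℕ) (w : Fin c → Fin n) (_hw : Function.Injective w),
    CentreWeakClass w p e ε S →
    ∀ [(centreIdeal K w).IsPrime],
      ((p ^ e : ℕ) : ℕ∞) ≤
        ordAlong (MvPowerSeries (Fin n) K) (centreIdeal K w)
          (HFlat.caseI (hasseD K n) hS.unit_u0.unit p (p ^ e)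
            (alpha S.support S.u) (beta S.support S.u) (gamma S.support S.u ⟨0, h0⟩) ε)

end CampaignW21

end Summit.ResolutionOfSingularities.ResolutionOfSingularities.Theorems

end
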